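import Literature.NumberTheory.NumberFields.BhargavaQuinticSpace
import Mathlib.FieldTheory.Galois.Infinite
import Mathlib.FieldTheory.KrullTopology
import Mathlib.RingTheory.Etale.Field
import Mathlib.FieldTheory.IsAlgClosed.AlgebraicClosure
import HarnessLib

/-!
# Bhargava's quintic space: Galois descent for the quintic algebra `K(A)` (part (a) of the fact)

Support file for the named fact
`Literature.NumberTheory.NumberFields.BhargavaQuinticSpace.WrightYukie1992_orbit_bijective_etaleQuintic`
(file `BhargavaQuinticSpace.lean`).  Everything here is PROVED.  For a field `k` with algebraic
closure `k̄` and `A ∈ V(k)`, the quintic algebra `K(A)` was defined as the `k`-algebra of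
`Gal(k̄/k)`-equivariant functions `Z_A(k̄) → k̄` on the geometric zero locus.  We prove the standard
Galois-descent description of such an algebra (Grothendieck's form of Galois theory: finite
continuous `Gal(k̄/k)`-sets ↔ finite étale `k`-algebras, cf. [Bhargava2008, §2 pp. 59–60] where the
five points `x^{(1)}, …, x^{(5)}` index the homomorphisms `K → k̄`):

* `mulActionGeomZeroLocus`: `Gal(k̄/k)` acts on `Z_A(k̄)`;
* `fieldOfDef p = k(p)`, the field generated by the normalised coordinates of `p ∈ ℙ³(k̄)`, and
  `stabilizer_eq_fixingSubgroup : Stab(p) = Gal(k̄/k(p))`;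
* `apply_mem_fieldOfDef`: an equivariant function takes values `f(p) ∈ k(p)` (uses
  `InfiniteGalois.fixedField_fixingSubgroup`, i.e. `k̄/k` Galois — here `char k = 0`);
* `OrbitReps.evalEquiv : K(A) ≃ₐ[k] Π_ω k(p_ω)` (evaluation at a system of representatives `p_ω` of
  the Galois orbits on `Z_A(k̄)`), with inverse `q = σ p_ω ↦ σ(a_ω)`;
* `finrank_quinticAlgebraOf_eq_ncard : dim_k K(A) = |Z_A(k̄)|` for finite `Z_A(k̄)`
  (`[k(p_ω) : k] = [Gal : Stab p_ω] = |orbit|`, `IntermediateField.finrank_eq_fixingSubgroup_index`);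
* `etale_quinticAlgebraOf`: `K(A)` is étale (`Algebra.Etale.iff_exists_algEquiv_prod`, `char k = 0`);
* **`etale_and_finrank_of_isNondegenerate` = part (a) of the fact**: for non-degenerate `A`,
  `K(A)` is an étale `k`-algebra of degree `5`.

## References

* M. Bhargava, *Higher composition laws IV*, Ann. of Math. 167 (2008), 53–94, §2. [Bhargava2008]
* A. Yukie, *Shintani Zeta Functions*, LMS LNS 183, CUP (1993), §0.4. [Yukie1993]
-/

noncomputable section

open Matrix
open scoped LinearAlgebra.Projectivization

namespace Literature.NumberTheory.NumberFields
namespace BhargavaQuinticSpace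

universe u

section Field

variable (k : Type u) [Field k]

/-! ### The Galois action on `ℙ³(k̄)` and on the zero locus is an action -/

/-- `galAct 1 = id`. [folklore] -/
theorem galAct_one (p : ℙ (AlgebraicClosure k) (Fin 4 → AlgebraicClosure k)) : galAct k 1 p = p := by
  induction p using Projectivization.ind with
  | h v hv =>
    rw [galAct_mk]
    congr 1

/-- `galAct (σ τ) = galAct σ ∘ galAct τ`. [folklore] -/
theorem galAct_mul (σ τ : AlgebraicClosure k ≃ₐ[k] AlgebraicClosure k)
    (p : ℙ (AlgebraicClosure k) (Fin 4 → AlgebraicClosure k)) :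
    galAct k (σ * τ) p = galAct k σ (galAct k τ p) := by
  induction p using Projectivization.ind with
  | h v hv =>
    simp only [galAct_mk]
    congr 1

/-- The action of `Gal(k̄/k)` on the geometric zero locus `Z_A(k̄)` (a finite `Gal(k̄/k)`-set for
non-degenerate `A`). [cite: Bhargava2008, §2 pp. 59–60] -/
instance mulActionGeomZeroLocus (x : BhargavaQuinticSpace k) :
    MulAction (AlgebraicClosure k ≃ₐ[k] AlgebraicClosure k) (geomZeroLocus k x) where
  smul σ p := ⟨galAct k σ p, galAct_mem_geomZeroLocus k x σ p.2⟩
  one_smul p := Subtype.ext (galAct_one k p)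
  mul_smul σ τ p := Subtype.ext (galAct_mul k σ τ p)

/-- Unfolding the action: `↑(σ • p) = galAct σ ↑p`. [folklore] -/
theorem coe_galSmul (x : BhargavaQuinticSpace k) (σ : AlgebraicClosure k ≃ₐ[k] AlgebraicClosure k)
    (p : geomZeroLocus k x) :
    ((σ • p : geomZeroLocus k x) : ℙ (AlgebraicClosure k) (Fin 4 → AlgebraicClosure k)) = galAct k σ p :=
  rfl

/-! ### Normalised representative and field of definition of a point of `ℙ³(k̄)` -/

/-- An index at which the chosen representative of `p ∈ ℙ³(k̄)` is non-zero. [folklore] -/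
def pivot (p : ℙ (AlgebraicClosure k) (Fin 4 → AlgebraicClosure k)) : Fin 4 :=
  Classical.choose (Function.ne_iff.mp p.rep_nonzero)

/-- The pivot coordinate of the chosen representative is non-zero. [folklore] -/
theorem rep_pivot_ne_zero (p : ℙ (AlgebraicClosure k) (Fin 4 → AlgebraicClosure k)) :
    p.rep (pivot k p) ≠ 0 :=
  Classical.choose_spec (Function.ne_iff.mp p.rep_nonzero)

/-- The representative of `p` normalised to have pivot coordinate `1`. [folklore] -/
def normRep (p : ℙ (AlgebraicClosure k) (Fin 4 → AlgebraicClosure k)) : Fin 4 → AlgebraicClosure k :=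
  (p.rep (pivot k p))⁻¹ • p.rep

/-- The normalised representative has pivot coordinate `1`. [folklore] -/
theorem normRep_pivot (p : ℙ (AlgebraicClosure k) (Fin 4 → AlgebraicClosure k)) :
    normRep k p (pivot k p) = 1 := by
  simp [normRep, rep_pivot_ne_zero]

/-- The normalised representative is non-zero. [folklore] -/
theorem normRep_ne_zero (p : ℙ (AlgebraicClosure k) (Fin 4 → AlgebraicClosure k)) : normRep k p ≠ 0 :=
  fun h => one_ne_zero ((normRep_pivot k p).symm.trans (congrFun h (pivot k p)))

/-- The normalised representative represents `p`. [folklore] -/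
theorem mk_normRep (p : ℙ (AlgebraicClosure k) (Fin 4 → AlgebraicClosure k)) :
    Projectivization.mk (AlgebraicClosure k) (normRep k p) (normRep_ne_zero k p) = p := by
  conv_rhs => rw [← p.mk_rep]
  rw [Projectivization.mk_eq_mk_iff']
  exact ⟨(p.rep (pivot k p))⁻¹, rfl⟩

/-- The FIELD OF DEFINITION `k(p) ⊆ k̄` of a point `p ∈ ℙ³(k̄)`: the intermediate field generated
by its normalised coordinates. [folklore] -/
def fieldOfDef (p : ℙ (AlgebraicClosure k) (Fin 4 → AlgebraicClosure k)) :
    IntermediateField k (AlgebraicClosure k) :=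
  IntermediateField.adjoin k (Set.range (normRep k p))

/-- `k(p)/k` is finite (finitely many algebraic generators). [folklore] -/
instance fieldOfDef_finiteDimensional (p : ℙ (AlgebraicClosure k) (Fin 4 → AlgebraicClosure k)) :
    FiniteDimensional k (fieldOfDef k p) :=
  IntermediateField.finiteDimensional_adjoin fun x _ => Algebra.IsIntegral.isIntegral x

/-- `σ` fixes `p` iff it fixes the normalised coordinates of `p` (compare pivot coordinates). [folklore] -/
theorem galAct_eq_self_iff (σ : AlgebraicClosure k ≃ₐ[k] AlgebraicClosure k)
    (p : ℙ (AlgebraicClosure k) (Fin 4 → AlgebraicClosure k)) :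
    galAct k σ p = p ↔ ∀ i, σ (normRep k p i) = normRep k p i := by
  conv_lhs => rw [← mk_normRep k p, galAct_mk]
  rw [Projectivization.mk_eq_mk_iff']
  constructor
  · rintro ⟨a, ha⟩
    have hpiv := congrFun ha (pivot k p)
    simp only [Pi.smul_apply, galSemilinear_apply, normRep_pivot, map_one, smul_eq_mul, mul_one] at hpiv
    subst hpiv
    intro i
    simpa using (congrFun ha i).symm
  · intro h
    exact ⟨1, by funext i; simp [h i]⟩

/-- `σ ∈ Gal(k̄/k(p))` iff `σ` fixes the normalised coordinates of `p`. [folklore] -/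
theorem mem_fixingSubgroup_fieldOfDef_iff (σ : AlgebraicClosure k ≃ₐ[k] AlgebraicClosure k)
    (p : ℙ (AlgebraicClosure k) (Fin 4 → AlgebraicClosure k)) :
    σ ∈ (fieldOfDef k p).fixingSubgroup ↔ ∀ i, σ (normRep k p i) = normRep k p i := by
  rw [IntermediateField.mem_fixingSubgroup_iff]
  constructor
  · intro h i
    exact h _ (IntermediateField.subset_adjoin k _ ⟨i, rfl⟩)
  · intro h x hx
    have hx' : x ∈ (fieldOfDef k p).toSubalgebra := hx
    rw [fieldOfDef, IntermediateField.adjoin_toSubalgebra_of_isAlgebraic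
      (fun y _ => Algebra.IsAlgebraic.isAlgebraic y)] at hx'
    have hle : Algebra.adjoin k (Set.range (normRep k p)) ≤
        AlgHom.equalizer (σ : AlgebraicClosure k →ₐ[k] AlgebraicClosure k) (AlgHom.id k _) := by
      rw [Algebra.adjoin_le_iff]
      rintro _ ⟨i, rfl⟩
      exact h i
    exact hle hx'

/-- `σ p = p ↔ σ ∈ Gal(k̄/k(p))`. [folklore] -/
theorem galAct_eq_self_iff_mem_fixingSubgroup (σ : AlgebraicClosure k ≃ₐ[k] AlgebraicClosure k)
    (p : ℙ (AlgebraicClosure k) (Fin 4 → AlgebraicClosure k)) :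
    galAct k σ p = p ↔ σ ∈ (fieldOfDef k p).fixingSubgroup := by
  rw [galAct_eq_self_iff, mem_fixingSubgroup_fieldOfDef_iff]

/-- **Stabiliser = Galois group of the field of definition**: `Stab(p) = Gal(k̄/k(p))`, an open
subgroup of index `[k(p) : k]`. [folklore] -/
theorem stabilizer_eq_fixingSubgroup (x : BhargavaQuinticSpace k) (p : geomZeroLocus k x) :
    MulAction.stabilizer (AlgebraicClosure k ≃ₐ[k] AlgebraicClosure k) p =
      (fieldOfDef k (p : ℙ (AlgebraicClosure k) (Fin 4 → AlgebraicClosure k))).fixingSubgroup := by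
  ext σ
  rw [MulAction.mem_stabilizer_iff, ← galAct_eq_self_iff_mem_fixingSubgroup, ← coe_galSmul]
  exact ⟨fun h => congrArg Subtype.val h, fun h => Subtype.ext h⟩

/-! ### Values of equivariant functions lie in the field of definition -/

variable [CharZero k] in
/-- A `Gal(k̄/k)`-equivariant function takes the value `f(p) ∈ k(p)` at `p` (`char k = 0`: `k̄/k` is
Galois and `k(p)` is the fixed field of `Gal(k̄/k(p))`). [folklore] -/
theorem apply_mem_fieldOfDef (x : BhargavaQuinticSpace k) (f : quinticAlgebraOf k x)
    (p : geomZeroLocus k x) :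
    (f : geomZeroLocus k x → AlgebraicClosure k) p ∈
      fieldOfDef k (p : ℙ (AlgebraicClosure k) (Fin 4 → AlgebraicClosure k)) := by
  rw [← InfiniteGalois.fixedField_fixingSubgroup (fieldOfDef k _),
    IntermediateField.mem_fixedField_iff]
  intro σ hσ
  rw [← galAct_eq_self_iff_mem_fixingSubgroup] at hσ
  exact (f.2 σ p p hσ).symm

/-! ### The evaluation isomorphism `K(A) ≃ₐ[k] Π_{orbits} k(p_ω)` -/

section Eval

variable (x : BhargavaQuinticSpace k)

/-- A system of representatives of the Galois orbits on `Z_A(k̄)`: a section `R` of the orbit map.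
[folklore] -/
structure OrbitReps where
  /-- the representatives -/
  R : MulAction.orbitRel.Quotient (AlgebraicClosure k ≃ₐ[k] AlgebraicClosure k) (geomZeroLocus k x) →
    geomZeroLocus k x
  mk_R : ∀ ω, (Quotient.mk _ (R ω) : MulAction.orbitRel.Quotient
    (AlgebraicClosure k ≃ₐ[k] AlgebraicClosure k) (geomZeroLocus k x)) = ω

/-- The canonical system of representatives (`Quotient.out`). [folklore] -/
def orbitReps : OrbitReps k x where
  R := Quotient.out
  mk_R := Quotient.out_eq

variable {k x}

namespace OrbitReps

variable (ρ : OrbitReps k x)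

local notation "Ω" => MulAction.orbitRel.Quotient (AlgebraicClosure k ≃ₐ[k] AlgebraicClosure k)
  (geomZeroLocus k x)

/-- The orbit index of a point of `Z_A(k̄)`. [folklore] -/
abbrev idx (q : geomZeroLocus k x) : Ω := Quotient.mk _ q

/-- Every point is a Galois translate of the representative of its orbit. [folklore] -/
theorem exists_smul_R_eq (q : geomZeroLocus k x) :
    ∃ σ : AlgebraicClosure k ≃ₐ[k] AlgebraicClosure k, σ • ρ.R (idx q) = q := by
  have h : (Quotient.mk _ (ρ.R (idx q)) : Ω) = Quotient.mk _ q := ρ.mk_R _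
  have h' : ρ.R (idx q) ∈ MulAction.orbit (AlgebraicClosure k ≃ₐ[k] AlgebraicClosure k) q :=
    MulAction.orbitRel_apply.mp (Quotient.exact h)
  obtain ⟨σ, hσ⟩ := MulAction.mem_orbit_iff.mp h'
  refine ⟨σ⁻¹, ?_⟩
  rw [← hσ, inv_smul_smul]

/-- A chosen Galois element moving the representative of the orbit of `q` to `q`. [folklore] -/
def mover (q : geomZeroLocus k x) : AlgebraicClosure k ≃ₐ[k] AlgebraicClosure k :=
  Classical.choose (ρ.exists_smul_R_eq q)

/-- Defining property of `mover`. [folklore] -/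
theorem mover_smul (q : geomZeroLocus k x) : ρ.mover q • ρ.R (idx q) = q :=
  Classical.choose_spec (ρ.exists_smul_R_eq q)

/-- The field `k(p_ω)` attached to an orbit `ω`: the field of definition of its representative.
[folklore] -/
abbrev fld (ω : Ω) : IntermediateField k (AlgebraicClosure k) :=
  fieldOfDef k (ρ.R ω : ℙ (AlgebraicClosure k) (Fin 4 → AlgebraicClosure k))

/-- Well-definedness of the inverse construction: if `σ p_ω = τ p_ω` then `σ` and `τ` agree on
`k(p_ω)`. [folklore] -/
theorem smul_apply_eq_of_smul_R_eq (a : (ω : Ω) → ρ.fld ω) (ω : Ω)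
    (σ τ : AlgebraicClosure k ≃ₐ[k] AlgebraicClosure k) (h : σ • ρ.R ω = τ • ρ.R ω) :
    σ ((a ω : ρ.fld ω) : AlgebraicClosure k) = τ ((a ω : ρ.fld ω) : AlgebraicClosure k) := by
  have hst : τ⁻¹ * σ ∈ MulAction.stabilizer (AlgebraicClosure k ≃ₐ[k] AlgebraicClosure k) (ρ.R ω) := by
    rw [MulAction.mem_stabilizer_iff, mul_smul, h, inv_smul_smul]
  rw [stabilizer_eq_fixingSubgroup, IntermediateField.mem_fixingSubgroup_iff] at hst
  have := hst _ (a ω).2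
  rw [AlgEquiv.mul_apply] at this
  simpa using congrArg τ this

/-- The inverse construction: from a family `a_ω ∈ k(p_ω)` to the equivariant function
`q = σ • p_ω ↦ σ (a_ω)`. [folklore] -/
def lift (a : (ω : Ω) → ρ.fld ω) : geomZeroLocus k x → AlgebraicClosure k :=
  fun q => ρ.mover q ((a (idx q) : ρ.fld (idx q)) : AlgebraicClosure k)

/-- `lift a (σ p_ω) = σ (a_ω)` for ANY `σ` moving `p_ω` to the point. [folklore] -/
theorem lift_apply_of_smul_R_eq (a : (ω : Ω) → ρ.fld ω) (q : geomZeroLocus k x)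
    (σ : AlgebraicClosure k ≃ₐ[k] AlgebraicClosure k) (h : σ • ρ.R (idx q) = q) :
    ρ.lift a q = σ ((a (idx q) : ρ.fld (idx q)) : AlgebraicClosure k) :=
  ρ.smul_apply_eq_of_smul_R_eq a (idx q) _ _ ((ρ.mover_smul q).trans h.symm)

/-- The lifted function is Galois-equivariant, i.e. lies in `K(A)`. [folklore] -/
theorem lift_mem (a : (ω : Ω) → ρ.fld ω) : ρ.lift a ∈ quinticAlgebraOf k x := by
  intro τ p q hpq
  have hpq' : τ • p = q := Subtype.ext hpq
  have hidx : idx q = idx p :=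
    Quotient.sound (MulAction.orbitRel_apply.mpr (MulAction.mem_orbit_iff.mpr ⟨τ, hpq'⟩))
  obtain ⟨σ, hσ⟩ := ρ.exists_smul_R_eq p
  rw [ρ.lift_apply_of_smul_R_eq a p σ hσ]
  have h2 : (τ * σ) • ρ.R (idx q) = q := by
    rw [hidx, mul_smul, hσ, hpq']
  rw [ρ.lift_apply_of_smul_R_eq a q (τ * σ) h2, AlgEquiv.mul_apply]
  have : ((a (idx q) : ρ.fld (idx q)) : AlgebraicClosure k) =
      ((a (idx p) : ρ.fld (idx p)) : AlgebraicClosure k) := by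
    rw [hidx]
  rw [this]

variable [CharZero k]

/-- Evaluation at the representative of `ω`, as a `k`-algebra map `K(A) → k(p_ω)`. [folklore] -/
def evalAt (ω : Ω) : quinticAlgebraOf k x →ₐ[k] ρ.fld ω where
  toFun f := ⟨(f : geomZeroLocus k x → AlgebraicClosure k) (ρ.R ω), apply_mem_fieldOfDef k x f _⟩
  map_one' := rfl
  map_mul' _ _ := rfl
  map_zero' := rfl
  map_add' _ _ := rfl
  commutes' _ := rfl

/-- The evaluation map `K(A) → Π_ω k(p_ω)`. [folklore] -/
def evalHom : quinticAlgebraOf k x →ₐ[k] ((ω : Ω) → ρ.fld ω) :=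
  AlgHom.pi fun ω => ρ.evalAt ω

/-- Unfolding `evalHom`. [folklore] -/
@[simp]
theorem evalHom_apply (f : quinticAlgebraOf k x) (ω : Ω) :
    ((ρ.evalHom f ω : ρ.fld ω) : AlgebraicClosure k) =
      (f : geomZeroLocus k x → AlgebraicClosure k) (ρ.R ω) :=
  rfl

/-- An equivariant function is determined by its values on orbit representatives. [folklore] -/
theorem evalHom_injective : Function.Injective ρ.evalHom := by
  intro f g hfg
  apply Subtype.ext
  funext q
  obtain ⟨σ, hσ⟩ := ρ.exists_smul_R_eq q
  have hf := f.2 σ (ρ.R (idx q)) q (by rw [← coe_galSmul, hσ])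
  have hg := g.2 σ (ρ.R (idx q)) q (by rw [← coe_galSmul, hσ])
  have h := congrArg (fun a => ((a (idx q) : ρ.fld (idx q)) : AlgebraicClosure k)) hfg
  simp only [evalHom_apply] at h
  rw [hf, hg, h]

/-- `evalHom ∘ lift = id`. [folklore] -/
theorem evalHom_lift (a : (ω : Ω) → ρ.fld ω) : ρ.evalHom ⟨ρ.lift a, ρ.lift_mem a⟩ = a := by
  funext ω
  apply Subtype.ext
  rw [evalHom_apply]
  change ρ.lift a (ρ.R ω) = _
  have hidx : idx (ρ.R ω) = ω := ρ.mk_R ω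
  have h1 : (1 : AlgebraicClosure k ≃ₐ[k] AlgebraicClosure k) • ρ.R (idx (ρ.R ω)) = ρ.R ω := by
    rw [one_smul, hidx]
  rw [ρ.lift_apply_of_smul_R_eq a (ρ.R ω) 1 h1, AlgEquiv.one_apply]
  have : ((a (idx (ρ.R ω)) : ρ.fld (idx (ρ.R ω))) : AlgebraicClosure k) =
      ((a ω : ρ.fld ω) : AlgebraicClosure k) := by
    rw [hidx]
  exact this

/-- Every family `(a_ω ∈ k(p_ω))_ω` is the family of values of an equivariant function. [folklore] -/
theorem evalHom_surjective : Function.Surjective ρ.evalHom :=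
  fun a => ⟨⟨ρ.lift a, ρ.lift_mem a⟩, ρ.evalHom_lift a⟩

/-- **Galois descent for `K(A)`**: `K(A) ≃ₐ[k] Π_ω k(p_ω)`, a finite product of finite extensions
of `k` inside `k̄`, indexed by the Galois orbits on `Z_A(k̄)` (for `A` attached to a quintic ring `R`,
`K(A) = R ⊗ ℚ` with `Hom(K(A), k̄) = Z_A(k̄)`). [cite: Bhargava2008, §2 pp. 59–60] -/
def evalEquiv : quinticAlgebraOf k x ≃ₐ[k] ((ω : Ω) → ρ.fld ω) :=
  AlgEquiv.ofBijective ρ.evalHom ⟨ρ.evalHom_injective, ρ.evalHom_surjective⟩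

/-- `[k(p_ω) : k] = |Gal · p_ω|` (fundamental theorem of infinite Galois theory for the open subgroup
`Stab(p_ω)`, plus orbit–stabiliser). [folklore] -/
theorem finrank_fld (ω : Ω) :
    Module.finrank k (ρ.fld ω) =
      Nat.card (MulAction.orbit (AlgebraicClosure k ≃ₐ[k] AlgebraicClosure k) (ρ.R ω)) := by
  rw [IntermediateField.finrank_eq_fixingSubgroup_index, ← stabilizer_eq_fixingSubgroup,
    Subgroup.index_eq_card,
    Nat.card_congr (MulAction.orbitEquivQuotientStabilizer
      (AlgebraicClosure k ≃ₐ[k] AlgebraicClosure k) (ρ.R ω))]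

end OrbitReps

variable [CharZero k]

/-- **Part (a), dimension**: `dim_k K(A) = |Z_A(k̄)|` whenever the zero locus is finite.
[cite: Bhargava2008, §2 pp. 59–60] -/
theorem finrank_quinticAlgebraOf_eq_ncard (hfin : (geomZeroLocus k x).Finite) :
    Module.finrank k (quinticAlgebraOf k x) = (geomZeroLocus k x).ncard := by
  classical
  haveI : Fintype (geomZeroLocus k x) := hfin.fintype
  let ρ := orbitReps k x
  rw [(ρ.evalEquiv).toLinearEquiv.finrank_eq, Module.finrank_pi_fintype,
    ← Nat.card_coe_set_eq,
    Nat.card_congr (MulAction.selfEquivSigmaOrbits (AlgebraicClosure k ≃ₐ[k] AlgebraicClosure k)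
      (geomZeroLocus k x)), Nat.card_sigma]
  refine Finset.sum_congr rfl fun ω _ => ?_
  exact ρ.finrank_fld ω

/-- **Part (a), étaleness**: `K(A)` is an étale `k`-algebra whenever the zero locus is finite
(`char k = 0`). [cite: Bhargava2008, §2 pp. 59–60 and §4 p. 70] -/
theorem etale_quinticAlgebraOf (hfin : (geomZeroLocus k x).Finite) :
    Algebra.Etale k (quinticAlgebraOf k x) := by
  classical
  haveI : Fintype (geomZeroLocus k x) := hfin.fintype
  let ρ := orbitReps k x
  refine (Algebra.Etale.iff_exists_algEquiv_prod k _).mpr ⟨_, inferInstance, fun ω => ρ.fld ω,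
    inferInstance, inferInstance, ρ.evalEquiv, fun ω => ⟨inferInstance, inferInstance⟩⟩

end Eval

variable [CharZero k] in
/-- **Part (a) of `WrightYukie1992_orbit_bijective_etaleQuintic`.** For non-degenerate `A ∈ V(k)`,
`char k = 0`, the quintic algebra `K(A)` is an étale `k`-algebra of degree `5`.
[cite: Bhargava2008, §4 p. 70; Yukie1993, §0.4] -/
theorem etale_and_finrank_of_isNondegenerate {x : BhargavaQuinticSpace k} (hx : IsNondegenerate k x) :
    Algebra.Etale k (quinticAlgebraOf k x) ∧ Module.finrank k (quinticAlgebraOf k x) = 5 :=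
  ⟨etale_quinticAlgebraOf hx.finite_geomZeroLocus,
    (finrank_quinticAlgebraOf_eq_ncard hx.finite_geomZeroLocus).trans hx.2.1⟩

end Field

end BhargavaQuinticSpace
end Literature.NumberTheory.NumberFields
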